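import Literature.AlgebraicGeometry.AbelianSchemes.AbelianSchemeDualTransport        -- ★ W3c: `transportMap`, `transportBundle(_fibrewisePicZero)`, `fibreIsoOfIso`
import Literature.AlgebraicGeometry.AbelianSchemes.RigidifiedLineBundleComapHom      -- ★ `baseChangeHom`, `RigidifiedLineBundle.comapHom`, `FibrewisePicZero.comapHom`
import Literature.AlgebraicGeometry.AbelianSchemes.RigidifyAlongUnitSlice           -- ★ `unitSection_baseChange_eq_unitSlice`
import Literature.AlgebraicGeometry.AbelianSchemes.AbelianSchemeDualTransportDualIsogeny  -- ★ `dualIsogeny`, `eq_dualIsogeny`, `pullbackSelfBundle`, `transportMap_eq_baseChangeHom_inv_left`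
import HarnessLib

/-!
# The dual pair of `A′` from a dual pair of `A` along an isomorphism `e : A ≅ A′` of abelian `S`-schemes — the CONSTRUCTOR `DualPair.ofIso`
# ([MumfordFogartyKirwan1994] Ch. 6 §1 Cor. 6.8, Ch. 7 §2 Def. 7.3; [MilneAV2008] I §8)

Topic `AlgebraicGeometry/AbelianSchemes`, namespace `Literature.AlgebraicGeometry.AbelianSchemes.AbelianSchemeOver.DualPair`.  ONE definition with body
(`DualPair.ofIso`, a structure literal) + four module-isomorphism defs (plumbing), and theorems; no `def … : Prop`, no named fact, no instance, no notation, no `sorry`.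
Cell `hodgecm-mathlib` (D-0151), F0∕P6 «MOD» line L3 (socket `stub_FROB`, road ROOF → `stub_ROOF0`; LA3-plan (g0) RULING «DUAL-B̄» #2, WORD «type (α)» to LA6-p03 (g0),
2026-09-02): the middle object `B̄` of Defs `Roof₀` must CARRY a `DualPair`; the tree's carriers with dual pairs (fibres of the universal family, engine quotients
`A/K`) are identified with the wanted carrier (a Serre tensor `A ⊗ 𝔭_w⁻¹`, ★ KER-EQ) only up to an ISOMORPHISM of abelian schemes — this file moves the dual pair
across such an isomorphism, so LA3-p01's roof legs (★ p847843 `RoofRetargetAlongRecognition`) keep `hat` LITERALLY.  `--supports stmt-HodgeConjecture-24832`,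
count-neutral.  HONEST LABEL: HC_CM is proved only modulo the cell's 2 remaining named inputs (hLiu418 24832, h413 24833) until rung 0 closes; this file
discharges none of them.

THE MATHEMATICS.  Let `D = (Â, 𝒫)` be a dual pair of `A∕S` ([MilneAV2008] I §8: `𝒫` on `A ×_S Â`, rigidified along `ε_A × 1`, fibrewise in `Pic⁰`, universal) and
`e : A ≅ A′` an isomorphism of abelian `S`-schemes (an `S`-group-scheme isomorphism).  Then `(Â, (e⁻¹ × 1)^*𝒫)` is a dual pair of `A′`: rank and rigidity
formally (`ε_{A′} ≫ e⁻¹ = ε_A`), fibrewise `Pic⁰` because the slices correspond under the fibre isomorphisms `A′_s ≅ A_s` ([MumfordAV1970] §8 (iv) ⇔ (i) is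
invariant under isomorphisms), and UNIVERSALITY because a rigidified fibrewise-`Pic⁰` family `ℒ` on `A′_T` is one on `A_T` after pull-back along
`e_T : A_T ≅ A′_T` (★ `RigidifiedLineBundle.comapHom e`), classified by a unique `g : T → Â`, and `(e_T) ≫ (1_{A′} × g) ≫ (e⁻¹ × 1) = 1_A × g` (§2 the key square)
— so the SAME `g` classifies `ℒ` for the transported Poincaré sheaf, and conversely ([MilneAV2008] I §8 «a unique regular map `α : T → A^∨` such that
`(1 × α)^*𝒫 ≈ ℒ`»; [MumfordFogartyKirwan1994] Def. 7.3: the dual is functorial in isomorphisms of polarised abelian schemes).  The data halves are ★ W3c's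
`transportMap D e = e⁻¹ × 1` and `transportBundle D e = (e⁻¹ × 1)^*𝒫` (rigidified, fibrewise `Pic⁰` as a family over `Â`), so §1–§3 are short.

* (§0 is ★ `RigidifyAlongUnitSlice.unitSection_baseChange_eq_unitSlice`: the identity section of `A ×_S B → B` IS the slice `ε_A × 1_B`.)
* §1 rank ∕ rigidity ∕ fibrewise `Pic⁰` of `(e⁻¹ × 1)^*𝒫` in the DUAL-PAIR currency (`unitSlice`, `fibreSlice`).
* §2 the key square `baseChangeHom_comp_baseChangeToProd_comp_transportMap` and the two module isomorphisms it induces; UNIVERSALITY `universal_ofIso`.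
* §3 **`DualPair.ofIso (D : A.DualPair) (e : A.X ≅ A′.X) [IsMonHom e.hom] : A′.DualPair`**, `ofIso_hat` (`rfl`: `hat` is LITERALLY `D.hat`), `ofIso_P` (`rfl`),
  **`classify_ofIso`** (`g′_ℒ = g_{e_T^* ℒ}`) and `pullbackP_ofIso` — what ★ p847843 §1 ∕ the σ2 pen rewrite with.
* §4 NATURALITY of ★ `dualIsogeny`∕`dualIsogenyOver` along `e` (the shared `hat`): `dualIsogeny ψ DB (D.ofIso e) = dualIsogeny (ψ ≫ e⁻¹) DB D` (target side) and
  `dualIsogeny φ (D.ofIso e) DB = dualIsogeny (e ≫ φ) D DB` (source side), by ★ `eq_dualIsogeny`.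

## References
* [MumfordFogartyKirwan1994] D. Mumford, J. Fogarty, F. Kirwan, *Geometric Invariant Theory*, 3rd ed. (1994), Ch. 6 §1 Cor. 6.8 (p. 118), §2 (p. 121), Ch. 7 §2
  Definition 7.3 (p. 130).
* [MilneAV2008] J. S. Milne, *Abelian Varieties* (v2.00, 2008), I §8 pp. 36–37.
* [MumfordAV1970] D. Mumford, *Abelian Varieties* (1970), §8 ((iv) ⇔ (i)).
* [GortzWedhorn2020] U. Görtz, T. Wedhorn, *Algebraic Geometry I*, 2nd ed. (2020), Section (4.7) (p. 135), Prop. 4.16 (p. 101).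
-/

set_option autoImplicit false

universe u

open CategoryTheory CategoryTheory.Limits AlgebraicGeometry MonoidalCategory

noncomputable section

namespace Literature.AlgebraicGeometry.AbelianSchemes

namespace AbelianSchemeOver

open Literature.AlgebraicGeometry.Motives Literature.AlgebraicGeometry.Modules
open Literature.AlgebraicGeometry.AbelianVarieties
open scoped MonObj

variable {S : Scheme.{u}}

namespace DualPair

variable {A A' : AbelianSchemeOver S} (D : A.DualPair) (e : A.X ≅ A'.X) [IsMonHom e.hom]

/-! ### §1 `(e⁻¹ × 1)^*𝒫` in the dual-pair currency: rank, rigidity along `ε_{A′} × 1`, fibrewise `Pic⁰` over `Â` -/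

/-- `(e⁻¹ × 1)^*𝒫` is a line bundle (★ `transportBundle`). [cite: MumfordFogartyKirwan1994, Ch. 6 §1 Cor. 6.8 (p. 118)] -/
theorem hasRank_transport : HasRank ((Scheme.Modules.pullback (transportMap D e)).obj D.P) 1 :=
  (transportBundle D e).hasRank_one

/-- **`(e⁻¹ × 1)^*𝒫` is rigidified along `ε_{A′} × 1_Â`** (★ `transportBundle`'s rigidification, read through §0). [cite: MumfordFogartyKirwan1994, Ch. 6 §2 (p. 121)] -/
theorem rigid_transport :
    Nonempty ((Scheme.Modules.pullback (A'.unitSlice D.hat)).obj ((Scheme.Modules.pullback (transportMap D e)).obj D.P) ≅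
      SheafOfModules.unit _) :=
  (transportBundle D e).rigid.map fun r =>
    ((Scheme.Modules.pullbackCongr (unitSection_baseChange_eq_unitSlice A' D.hat)).app _).symm ≪≫ r

/-- The fibre identification `(A′ ×_S Â)_b ≅ A′_{b ≫ π̂}` followed by the slice at `b` is the first projection of the fibre. [cite: MilneAV2008, I §8 pp. 36–37] -/
theorem fibreBaseChangeIso_hom_comp_fibreSlice {Ω : Type u} [Field Ω] (b : Spec (.of Ω) ⟶ D.hat.X.left) :
    AbelianVariety.Hom.toSchemeHom (A'.fibreBaseChangeIso D.hat.X.hom b).hom ≫ A'.fibreSlice D.hat b =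
      pullback.fst (A'.baseChange D.hat.X.hom).X.hom b := by
  have hcond : pullback.fst (A'.baseChange D.hat.X.hom).X.hom b ≫ pullback.snd A'.X.hom D.hat.X.hom =
      pullback.snd (A'.baseChange D.hat.X.hom).X.hom b ≫ b := pullback.condition
  apply pullback.hom_ext
  · exact (Category.assoc _ _ _).trans
      ((congrArg (fun x => AbelianVariety.Hom.toSchemeHom (A'.fibreBaseChangeIso D.hat.X.hom b).hom ≫ x) (A'.fibreSlice_fst D.hat b)).trans
        (A'.fibreBaseChangeIso_hom_toSchemeHom_fst D.hat.X.hom b))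
  · exact (Category.assoc _ _ _).trans
      ((congrArg (fun x => AbelianVariety.Hom.toSchemeHom (A'.fibreBaseChangeIso D.hat.X.hom b).hom ≫ x) (A'.fibreSlice_snd D.hat b)).trans
        ((Category.assoc _ _ _).symm.trans
          ((congrArg (fun x => x ≫ b) (A'.fibreBaseChangeIso_hom_toSchemeHom_snd D.hat.X.hom b)).trans hcond.symm)))

/-- **`(e⁻¹ × 1)^*𝒫` lies fibrewise in `Pic⁰` over `Â`** in the dual-pair currency: its slice over a geometric point `b` of `Â` is translation invariant on
`A′_{b ≫ π̂}` (★ `transportBundle_fibrewisePicZero`, moved along `(A′ ×_S Â)_b ≅ A′_{b ≫ π̂}`). [cite: MumfordAV1970, §8 ((iv) ⇔ (i))] [cite: MilneAV2008, I §8 pp. 36–37] -/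
theorem fibrewisePicZero_transport (Ω : Type u) [Field Ω] [IsAlgClosed Ω] (b : Spec (.of Ω) ⟶ D.hat.X.left) :
    IsHomogeneous (A'.fibre (b ≫ D.hat.X.hom)).toAbelianVariety
      ((Scheme.Modules.pullback (A'.fibreSlice D.hat b)).obj ((Scheme.Modules.pullback (transportMap D e)).obj D.P)) := by
  have k := transportBundle_fibrewisePicZero D e Ω b
  have j : (transportBundle D e).fibreModule b ≅
      (Scheme.Modules.pullback (AbelianVariety.Hom.toSchemeHom (A'.fibreBaseChangeIso D.hat.X.hom b).hom)).obj
        ((Scheme.Modules.pullback (A'.fibreSlice D.hat b)).obj ((Scheme.Modules.pullback (transportMap D e)).obj D.P)) :=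
    ((Scheme.Modules.pullbackCongr (fibreBaseChangeIso_hom_comp_fibreSlice D b)).app _).symm ≪≫
      ((Scheme.Modules.pullbackComp _ _).app _).symm
  exact (isHomogeneous_pullback_iff_of_iso (A'.fibreBaseChangeIso D.hat.X.hom b) _).1 ((isHomogeneous_iff_of_iso _ j).1 k)

/-! ### §2 The key square and universality -/

section Universal

variable {T : Scheme.{u}} (f : T ⟶ S)

omit [IsMonHom e.hom] in
/-- `e_T ≫ e⁻¹_T = 𝟙` on underlying schemes. [cite: GortzWedhorn2020, Section (4.7) (p. 135)] -/
theorem baseChangeHom_hom_left_comp_baseChangeHom_inv_left :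
    (baseChangeHom e.hom f).left ≫ (baseChangeHom e.inv f).left = 𝟙 _ := by
  have h : baseChangeHom e.hom f ≫ baseChangeHom e.inv f = 𝟙 _ := by
    change (Over.pullback f).map e.hom ≫ (Over.pullback f).map e.inv = 𝟙 _
    rw [← CategoryTheory.Functor.map_comp, Iso.hom_inv_id, CategoryTheory.Functor.map_id]
  rw [← Over.comp_left, h, Over.id_left]

omit [IsMonHom e.hom] in
/-- `e⁻¹_T ≫ e_T = 𝟙` on underlying schemes. [cite: GortzWedhorn2020, Section (4.7) (p. 135)] -/
theorem baseChangeHom_inv_left_comp_baseChangeHom_hom_left :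
    (baseChangeHom e.inv f).left ≫ (baseChangeHom e.hom f).left = 𝟙 _ := by
  have h : baseChangeHom e.inv f ≫ baseChangeHom e.hom f = 𝟙 _ := by
    change (Over.pullback f).map e.inv ≫ (Over.pullback f).map e.hom = 𝟙 _
    rw [← CategoryTheory.Functor.map_comp, Iso.inv_hom_id, CategoryTheory.Functor.map_id]
  rw [← Over.comp_left, h, Over.id_left]

omit [IsMonHom e.hom] in
/-- **THE KEY SQUARE**: `e_T ≫ (1_{A′} × g) ≫ (e⁻¹ × 1) = 1_A × g : A_T → A ×_S Â` for every `g : T → Â` over `f`.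
[cite: MilneAV2008, I §8 pp. 36–37] [cite: GortzWedhorn2020, Section (4.7) (p. 135)] -/
theorem baseChangeHom_comp_baseChangeToProd_comp_transportMap (g : T ⟶ D.hat.X.left) (hg : g ≫ D.hat.X.hom = f) :
    (baseChangeHom e.hom f).left ≫ A'.baseChangeToProd D.hat f g hg ≫ transportMap D e = A.baseChangeToProd D.hat f g hg := by
  have hee : e.hom.left ≫ e.inv.left = 𝟙 _ := by rw [← Over.comp_left, Iso.hom_inv_id, Over.id_left]
  have hsnd : (baseChangeHom e.hom f).left ≫ pullback.snd A'.X.hom f = pullback.snd A.X.hom f := Over.w (baseChangeHom e.hom f)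
  have h1 : (baseChangeHom e.hom f).left ≫ pullback.fst A'.X.hom f = pullback.fst A.X.hom f ≫ e.hom.left :=
    baseChangeHom_left_comp_fst e.hom f
  apply pullback.hom_ext
  · -- first projection: `ι ≫ (1 × g) ≫ (e⁻¹ × 1) ≫ fst = ι ≫ fst′ ≫ e⁻¹ = fst ≫ e ≫ e⁻¹ = fst`
    exact (Category.assoc _ _ _).trans
      ((congrArg (fun x => (baseChangeHom e.hom f).left ≫ x)
          ((Category.assoc _ _ _).trans
            ((congrArg (fun x => A'.baseChangeToProd D.hat f g hg ≫ x) (transportMap_fst D e)).trans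
              ((Category.assoc _ _ _).symm.trans
                (congrArg (fun x => x ≫ e.inv.left) (A'.baseChangeToProd_fst D.hat f g hg)))))).trans
        ((Category.assoc _ _ _).symm.trans
          ((congrArg (fun x => x ≫ e.inv.left) h1).trans
            ((Category.assoc _ _ _).trans
              ((congrArg (fun x => pullback.fst A.X.hom f ≫ x) hee).trans
                ((Category.comp_id _).trans (A.baseChangeToProd_fst D.hat f g hg).symm))))))
  · -- second projection: `ι ≫ (1 × g) ≫ (e⁻¹ × 1) ≫ snd = ι ≫ snd′ ≫ g = snd ≫ g`
    exact (Category.assoc _ _ _).trans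
      ((congrArg (fun x => (baseChangeHom e.hom f).left ≫ x)
          ((Category.assoc _ _ _).trans
            ((congrArg (fun x => A'.baseChangeToProd D.hat f g hg ≫ x) (transportMap_snd D e)).trans
              (A'.baseChangeToProd_snd D.hat f g hg)))).trans
        ((Category.assoc _ _ _).symm.trans
          ((congrArg (fun x => x ≫ g) hsnd).trans (A.baseChangeToProd_snd D.hat f g hg).symm)))

omit [IsMonHom e.hom] in
/-- The same square started at `A′_T`: `(1_{A′} × g) ≫ (e⁻¹ × 1) = e⁻¹_T ≫ (1_A × g)`. [cite: MilneAV2008, I §8 pp. 36–37] -/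
theorem baseChangeToProd_comp_transportMap_eq_inv_comp (g : T ⟶ D.hat.X.left) (hg : g ≫ D.hat.X.hom = f) :
    A'.baseChangeToProd D.hat f g hg ≫ transportMap D e = (baseChangeHom e.inv f).left ≫ A.baseChangeToProd D.hat f g hg :=
  ((Category.id_comp _).symm.trans
    ((congrArg (fun x => x ≫ (A'.baseChangeToProd D.hat f g hg ≫ transportMap D e))
        (baseChangeHom_inv_left_comp_baseChangeHom_hom_left e f).symm).trans
      (Category.assoc _ _ _))).trans
    (congrArg (fun x => (baseChangeHom e.inv f).left ≫ x) (baseChangeHom_comp_baseChangeToProd_comp_transportMap D e f g hg))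

/-- **`(1_{A′} × g)^* (e⁻¹ × 1)^*𝒫 ≅ (e⁻¹_T)^* (1_A × g)^*𝒫`.** [cite: MilneAV2008, I §8 pp. 36–37] -/
def pullbackTransportIso (g : T ⟶ D.hat.X.left) (hg : g ≫ D.hat.X.hom = f) :
    (Scheme.Modules.pullback (A'.baseChangeToProd D.hat f g hg)).obj ((Scheme.Modules.pullback (transportMap D e)).obj D.P) ≅
      (Scheme.Modules.pullback (baseChangeHom e.inv f).left).obj (D.pullbackP f g hg) :=
  (Scheme.Modules.pullbackComp _ _).app D.P ≪≫
    (Scheme.Modules.pullbackCongr (baseChangeToProd_comp_transportMap_eq_inv_comp D e f g hg)).app D.P ≪≫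
    ((Scheme.Modules.pullbackComp _ _).app D.P).symm

/-- **`(1_A × g)^*𝒫 ≅ e_T^* (1_{A′} × g)^* (e⁻¹ × 1)^*𝒫`.** [cite: MilneAV2008, I §8 pp. 36–37] -/
def pullbackPIsoPullbackHom (g : T ⟶ D.hat.X.left) (hg : g ≫ D.hat.X.hom = f) :
    D.pullbackP f g hg ≅ (Scheme.Modules.pullback (baseChangeHom e.hom f).left).obj
      ((Scheme.Modules.pullback (A'.baseChangeToProd D.hat f g hg)).obj ((Scheme.Modules.pullback (transportMap D e)).obj D.P)) :=
  (Scheme.Modules.pullbackCongr (baseChangeHom_comp_baseChangeToProd_comp_transportMap D e f g hg).symm).app D.P ≪≫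
    ((Scheme.Modules.pullbackComp _ _).app D.P).symm ≪≫
    (Scheme.Modules.pullback (baseChangeHom e.hom f).left).mapIso ((Scheme.Modules.pullbackComp _ _).app D.P).symm

/-- `(e⁻¹_T)^* e_T^* M ≅ M`. [cite: GortzWedhorn2020, Section (4.7) (p. 135)] -/
def pullbackInvPullbackHomIso' (M : (A'.baseChange f).left.Modules) :
    (Scheme.Modules.pullback (baseChangeHom e.inv f).left).obj ((Scheme.Modules.pullback (baseChangeHom e.hom f).left).obj M) ≅ M :=
  (Scheme.Modules.pullbackComp _ _).app M ≪≫
    (Scheme.Modules.pullbackCongr (baseChangeHom_inv_left_comp_baseChangeHom_hom_left e f)).app M ≪≫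
    (Scheme.Modules.pullbackId _).app M

/-- **UNIVERSALITY of `(Â, (e⁻¹ × 1)^*𝒫)` for `A′`**: a rigidified fibrewise-`Pic⁰` family `ℒ` on `A′_T` pulls back along `e_T` to one on `A_T` (★ `comapHom`), which
`D` classifies by a unique `g : T → Â` over `f`; by the key square the same `g` (and only it) classifies `ℒ` for the transported Poincaré sheaf.
[cite: MilneAV2008, I §8 pp. 36–37] [cite: MumfordFogartyKirwan1994, Ch. 7 §2 Definition 7.3 (p. 130)] -/
theorem universal_ofIso (ℒ : A'.RigidifiedLineBundle f) (hℒ : ℒ.FibrewisePicZero) :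
    ∃! g : {g : T ⟶ D.hat.X.left // g ≫ D.hat.X.hom = f},
      Nonempty ((Scheme.Modules.pullback (A'.baseChangeToProd D.hat f g.1 g.2)).obj
        ((Scheme.Modules.pullback (transportMap D e)).obj D.P) ≅ ℒ.L) := by
  have hℒ₀ : (ℒ.comapHom e.hom).FibrewisePicZero := hℒ.comapHom e.hom
  refine ⟨⟨D.classify f (ℒ.comapHom e.hom) hℒ₀, D.classify_comp_hom _ _ _⟩, ?_, ?_⟩
  · -- existence: move `(1_A × g)^*𝒫 ≅ e_T^* ℒ` back along `e⁻¹_T`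
    obtain ⟨i⟩ := D.nonempty_pullbackP_classify_iso f (ℒ.comapHom e.hom) hℒ₀
    exact ⟨pullbackTransportIso D e f _ _ ≪≫ (Scheme.Modules.pullback (baseChangeHom e.inv f).left).mapIso i ≪≫
      pullbackInvPullbackHomIso' e f ℒ.L⟩
  · -- uniqueness: `g′` classifies `e_T^* ℒ` for `D`
    rintro ⟨g', hg'⟩ ⟨i⟩
    apply Subtype.ext
    exact D.eq_classify f (ℒ.comapHom e.hom) hℒ₀ g' hg'
      ⟨pullbackPIsoPullbackHom D e f g' hg' ≪≫ (Scheme.Modules.pullback (baseChangeHom e.hom f).left).mapIso i⟩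

end Universal

/-! ### §3 The constructor `DualPair.ofIso` -/

/-- **THE DUAL PAIR OF `A′` ALONG `e : A ≅ A′`**: `(Â, (e⁻¹ × 1)^*𝒫)` — `hat` is LITERALLY `D.hat`, the Poincaré sheaf is ★ `transportBundle D e`'s module; the four
clauses of [MilneAV2008] I §8 are §1 (rank, rigidity, fibrewise `Pic⁰`) and §2 (universality).
[cite: MumfordFogartyKirwan1994, Ch. 6 §1 Cor. 6.8 (p. 118) and Ch. 7 §2 Definition 7.3 (p. 130)] [cite: MilneAV2008, I §8 pp. 36–37] -/
def ofIso : A'.DualPair where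
  hat := D.hat
  P := (Scheme.Modules.pullback (transportMap D e)).obj D.P
  hasRank_one := hasRank_transport D e
  rigid := rigid_transport D e
  fibrewisePicZero := fibrewisePicZero_transport D e
  universal := fun f ℒ hℒ => universal_ofIso D e f ℒ hℒ

/-- The dual abelian scheme of `D.ofIso e` is `Â` (definitional). [cite: MumfordFogartyKirwan1994, Ch. 7 §2 Definition 7.3 (p. 130)] -/
@[simp] theorem ofIso_hat : (D.ofIso e).hat = D.hat := rfl

/-- The Poincaré sheaf of `D.ofIso e` is `(e⁻¹ × 1)^*𝒫` (definitional). [cite: MilneAV2008, I §8 pp. 36–37] -/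
@[simp] theorem ofIso_P : (D.ofIso e).P = (Scheme.Modules.pullback (transportMap D e)).obj D.P := rfl

/-- `(1_{A′} × g)^*` of the transported Poincaré sheaf is `(e⁻¹_T)^* (1_A × g)^*𝒫` (the `pullbackP` of `D.ofIso e` through that of `D`).
[cite: MilneAV2008, I §8 pp. 36–37] -/
def pullbackP_ofIso {T : Scheme.{u}} (f : T ⟶ S) (g : T ⟶ D.hat.X.left) (hg : g ≫ D.hat.X.hom = f) :
    (D.ofIso e).pullbackP f g hg ≅ (Scheme.Modules.pullback (baseChangeHom e.inv f).left).obj (D.pullbackP f g hg) :=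
  pullbackTransportIso D e f g hg

/-- **THE CLASSIFYING MAPS CORRESPOND: `g′_ℒ = g_{e_T^* ℒ}`** — the classifying morphism of a rigidified fibrewise-`Pic⁰` family `ℒ` on `A′_T` for `D.ofIso e` is the
classifying morphism of `e_T^* ℒ` for `D` (uniqueness in [MilneAV2008] I §8). [cite: MilneAV2008, I §8 pp. 36–37] -/
theorem classify_ofIso {T : Scheme.{u}} (f : T ⟶ S) (ℒ : A'.RigidifiedLineBundle f) (hℒ : ℒ.FibrewisePicZero) :
    (D.ofIso e).classify f ℒ hℒ = D.classify f (ℒ.comapHom e.hom) (hℒ.comapHom e.hom) := by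
  obtain ⟨i⟩ := (D.ofIso e).nonempty_pullbackP_classify_iso f ℒ hℒ
  exact D.eq_classify f (ℒ.comapHom e.hom) (hℒ.comapHom e.hom) _ ((D.ofIso e).classify_comp_hom f ℒ hℒ)
    ⟨pullbackPIsoPullbackHom D e f _ _ ≪≫ (Scheme.Modules.pullback (baseChangeHom e.hom f).left).mapIso i⟩

/-! ### §4 Naturality of the dual homomorphism along `e`: `hat` is shared, so `ψ^∨` for `D.ofIso e` is `(ψ ≫ e⁻¹)^∨` ∕ `(e ≫ φ)^∨` for `D` -/

section DualIsogeny

variable {B : AbelianSchemeOver S} (DB : B.DualPair)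

/-- **TARGET-SIDE NATURALITY**: for a homomorphism `ψ : B → A′`, the dual homomorphism `ψ^∨ : Â′ = Â → B̂` computed with `D.ofIso e` is `(ψ ≫ e⁻¹)^∨`
computed with `D` (both classify `(ψ × 1)^*(e⁻¹ × 1)^*𝒫 = ((ψ ≫ e⁻¹) × 1)^*𝒫`; uniqueness ★ `eq_dualIsogeny`) — the rewrite the ROOF legs use after re-targeting along `E`
(★ p847843 §1). [cite: MumfordAV1970, §15 Thm. 1 (p. 143)] [cite: MilneAV2008, I §9 Thm. 9.1 (p. 42)] -/
theorem dualIsogeny_ofIso_right (ψ : B.X ⟶ A'.X) [IsMonHom ψ] :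
    dualIsogeny ψ DB (D.ofIso e) = dualIsogeny (ψ ≫ e.inv) DB D := by
  haveI : IsMonHom e.inv := inferInstance
  have hcomp : (baseChangeHom ψ D.hat.X.hom).left ≫ transportMap D e = (baseChangeHom (ψ ≫ e.inv) D.hat.X.hom).left :=
    (congrArg (fun x => (baseChangeHom ψ D.hat.X.hom).left ≫ x) (transportMap_eq_baseChangeHom_inv_left D e)).trans
      ((Over.comp_left _ _ _ (baseChangeHom ψ D.hat.X.hom) (baseChangeHom e.inv D.hat.X.hom)).symm.trans
        (congrArg Over.Hom.left ((Over.pullback D.hat.X.hom).map_comp ψ e.inv).symm))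
  obtain ⟨i⟩ := nonempty_pullbackP_dualIsogeny_iso ψ DB (D.ofIso e)
  exact eq_dualIsogeny (ψ ≫ e.inv) DB D _ (dualIsogeny_comp_hom ψ DB (D.ofIso e))
    ⟨i ≪≫ (Scheme.Modules.pullbackComp _ _).app D.P ≪≫ (Scheme.Modules.pullbackCongr hcomp).app D.P⟩

/-- **SOURCE-SIDE NATURALITY**: for a homomorphism `φ : A′ → B`, `φ^∨ : B̂ → Â′ = Â` computed with `D.ofIso e` is `(e ≫ φ)^∨` computed with `D`
(`classify_ofIso` + `(e_T)^*(φ_T)^* = ((e ≫ φ)_T)^*`; uniqueness ★ `eq_dualIsogeny`). [cite: MumfordAV1970, §15 Thm. 1 (p. 143)] [cite: MilneAV2008, I §9 Thm. 9.1 (p. 42)] -/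
theorem dualIsogeny_ofIso_left (φ : A'.X ⟶ B.X) [IsMonHom φ] :
    dualIsogeny φ (D.ofIso e) DB = dualIsogeny (e.hom ≫ φ) D DB := by
  have hcomp : (baseChangeHom e.hom DB.hat.X.hom).left ≫ (baseChangeHom φ DB.hat.X.hom).left = (baseChangeHom (e.hom ≫ φ) DB.hat.X.hom).left := by
    rw [← Over.comp_left]
    exact congrArg Over.Hom.left ((Over.pullback DB.hat.X.hom).map_comp e.hom φ).symm
  have h1 : dualIsogeny φ (D.ofIso e) DB =
      D.classify DB.hat.X.hom ((pullbackSelfBundle φ DB).comapHom e.hom) ((pullbackSelfBundle_fibrewisePicZero φ DB).comapHom e.hom) :=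
    classify_ofIso D e DB.hat.X.hom (pullbackSelfBundle φ DB) (pullbackSelfBundle_fibrewisePicZero φ DB)
  rw [h1]
  obtain ⟨i⟩ := D.nonempty_pullbackP_classify_iso DB.hat.X.hom ((pullbackSelfBundle φ DB).comapHom e.hom)
    ((pullbackSelfBundle_fibrewisePicZero φ DB).comapHom e.hom)
  exact eq_dualIsogeny (e.hom ≫ φ) D DB _ (D.classify_comp_hom _ _ _)
    ⟨i ≪≫ (Scheme.Modules.pullbackComp _ _).app DB.P ≪≫ (Scheme.Modules.pullbackCongr hcomp).app DB.P⟩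

/-- The same two laws for `dualIsogenyOver` (as morphisms of `Over S`). [cite: MumfordAV1970, §15 Thm. 1 (p. 143)] -/
theorem dualIsogenyOver_ofIso_right (ψ : B.X ⟶ A'.X) [IsMonHom ψ] :
    dualIsogenyOver ψ DB (D.ofIso e) = dualIsogenyOver (ψ ≫ e.inv) DB D :=
  Over.OverMorphism.ext (dualIsogeny_ofIso_right D e DB ψ)

/-- The same two laws for `dualIsogenyOver` (as morphisms of `Over S`). [cite: MumfordAV1970, §15 Thm. 1 (p. 143)] -/
theorem dualIsogenyOver_ofIso_left (φ : A'.X ⟶ B.X) [IsMonHom φ] :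
    dualIsogenyOver φ (D.ofIso e) DB = dualIsogenyOver (e.hom ≫ φ) D DB :=
  Over.OverMorphism.ext (dualIsogeny_ofIso_left D e DB φ)

end DualIsogeny

end DualPair

end AbelianSchemeOver

end Literature.AlgebraicGeometry.AbelianSchemes

end
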